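import Summits.BirchSwinnertonDyer.Rank1Residual.Additive.GordDescentField
import Summits.BirchSwinnertonDyer.Rank1Residual.Additive.CyclotomicQuadraticSubfield
import Summits.BirchSwinnertonDyer.Rank1Residual.Additive.CyclotomicPrimeReduction
import Summits.BirchSwinnertonDyer.Rank1Residual.Additive.CyclotomicSubfields
import Summits.BirchSwinnertonDyer.Rank1Residual.Additive.CyclotomicGoodOrdinary
import Literature.NumberTheory.EllipticCurves.Delbourgo2002.PAdicBSDLeadingTerm
import Literature.NumberTheory.EllipticCurves.SelmerCorankControlRatProofs
import Literature.NumberTheory.EllipticCurves.PAdicGrossZagierConstantTermProofs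
import Literature.NumberTheory.Automorphic.SolvableBaseChangeModularityProofs
import Summits.BirchSwinnertonDyer.Rank1Residual.GaloisImage.FrobeniusOrderWitness
import HarnessLib

/-!
# Defect 2 (`I₀*`): Delbourgo's NON-ANOMALOUS clause `ReductionNonAnomalous W p` is DECIDED by
# `a_p(E^{(p*)})` — `ReductionNonAnomalous W p ↔ p ∤ #Ẽ^{(p*)}(𝔽_p) ↔ a_p(E^{(p*)}) ≢ 1 (mod p)`
# (cell `b2b-bsdres`, team n1011, seat p10 gen 2; item T-O7K3-B6 of the lead's R5-12)

HONEST FRAMING (cell `b2b-bsdres`, run/shared/lean/b2b/bsd-rank1-residual/, verbatim in every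
file): the goal of the cell is to DELETE the COMBINATION-SHAPED residual classes of the
Birch–Swinnerton-Dyer formula for ALL analytic-rank `≤ 1` elliptic curves over `ℚ` — "full BSD
formula for every rank `≤ 1` curve in class `C`" assembled STRICTLY from published theorems — so
that the rank-`≤ 1` remainder becomes exactly the CONSTRUCTION-SHAPED classes, which are TYPED
(missing-input `Prop`s), NOT attempted. This is not "finishing BSD". Team n1011 (N10/N11: X4 ∧
`p = 3`; O7): research routes on the CONSTRUCTION-SHAPED classes; prove what is provable now; no
claim beyond stated classes; census output = EVIDENCE / conjecture items, never a Literature fact;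
labels UNCHANGED; nothing is booked by this file. Theorems only (no definition, no named fact).

## What and why

Delbourgo 2002 Thm. (B) (A175 `Delbourgo2002.mainTheorem`, p16's `mainTheorem_three`, A190
`mainTheorem_potMult`) carries the factor `ℓ_p(E)`, transcribed as `ℓ ∣ p²` with `ℓ = 1` under
`Delbourgo2002.ReductionNonAnomalous W p`: "for every `p`-th cyclotomic field `L ⊇ F ∋ w ∣ p` with
`E_F` good at `w`, `p ∤ #Ẽ_{F,w}(k_w)`". Every rank-`1` theorem of the (G-ord) chain
(n1011-p01 `GordCycRankOneLambda`, `GordThreeCycRankOne`; additive-p2 gen 19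
`GordRankOneKatoCertificateBSD`; p12-g2 T-O7K3 `GordRankOneKatoCertificateThree`) binds it as the
hypothesis `hna`. On the potentially multiplicative locus it is a theorem (`PotMult.reductionNonAnomalous`,
vacuously: no good place above `p`), on defect `4` at `p ≥ 7` it is a theorem
(`reductionNonAnomalous_of_semistabilityIndex_eq_four`); on DEFECT 2 (Kodaira `I₀*`, the bulk of
X3♯(G-ord)/X4♯(G-ord) and all of it at `p = 3`) it is a genuine per-pair DATUM — this file says
WHICH datum, in the kernel, for every prime `p ≠ 2`:

* `hasGoodReductionAt_and_natCard_point_reductionAt_eq_of_twist_model` — for ANY number field `F`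
  containing a square root `k` of `d`, any globally minimal model `V` of `E^{(d)}` with good
  reduction at `p` and any place `w ∋ p` of `F` with `N(w) = p`: `E_F` is good at `w` and
  `#Ẽ_{F,w}(k_w) = #Ṽ(𝔽_p)` (`reductionPointCount V p`) — the twisting isomorphism
  `E_F ≅ (E^{(d)})_F ≅ V_F` (additive-p2 gen 6 `exists_variableChange_baseChange_eq_quadraticTwist`),
  isomorphism invariance of good reduction and of `a_w` (`hasGoodReductionAt_smul_iff_holds`,
  `frobeniusTraceAt_smul`), and `a_w(V_F) = a_p(V)` at a degree-one place
  (`frobeniusTraceAt_baseChange_eq_frobeniusTrace_prime`);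
* **`reductionNonAnomalous_iff_of_semistabilityIndex_eq_two`** — `p ≠ 2`, `W` globally minimal
  with `e_E(p) = 2`, `V` a globally minimal model of `E^{(p*)}` (`p* = (−1)^{⌊p/2⌋} p`) with good
  reduction at `p`: `ReductionNonAnomalous W p ↔ ¬ p ∣ reductionPointCount V p`. (⇐): a good place
  `w ∣ p` of a subfield `F ⊆ ℚ(ζ_p)` has `e(w|p) = [F : ℚ]` divisible by `e_E(p) = 2`
  (`semistabilityIndex_dvd_ramificationIdx_of_hasGoodReductionAt`,
  `ramificationIdx_eq_finrank_of_intermediateField_cyclotomic`), so `√p* ∈ F`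
  (`mem_iff_two_dvd_finrank_of_sq_eq_pStar`), `N(w) = p`
  (`absNorm_eq_of_intermediateField_cyclotomic`), and the first bullet applies; (⇒): evaluate the
  clause at `F = ℚ(√p*) ⊆ ℚ(ζ_p)`;
* `reductionNonAnomalous_iff_not_dvd_frobeniusTrace_sub_one_of_semistabilityIndex_eq_two` — the
  same as `¬ (p : ℤ) ∣ a_p(V) − 1`, i.e. "`E^{(p*)}` is non-anomalous at `p`" (Mazur); at `p = 3`
  with `V` ordinary: `a₃(E^{(−3)}) ∈ {−1, 2}` (the cell's TWIST-SIGN CONVENTION OF RECORD, lead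
  R5-12: the datum is read on `E^{(−3)}`, NOT on `E^{(+3)}`, whose `a₃` has the opposite sign).
So on every defect-2 row the binder `hna` of the rank-one chain is ONE decidable integer condition
on the semistable twist, computable from Cremona's `a_p` — for per-pair RECORDS it is discharged
by a kernel point count on `V`'s integral model (`frobeniusTrace_eq`). Nothing booked; no class
theorem changes; O7 / N10 marks UNCHANGED.

References: D. Delbourgo, J. Number Theory 95 (2002) p. 39 (`ℓ_p(E)`, `Ĩ(𝔽_p)`), pp. 69–70
[Delbourgo2002]; B. Mazur, Invent. Math. 18 (1972) (anomalous primes) [Mazur1972]; J. H. Silverman,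
*AEC* VII.1 Prop. 1.3(b), VII.5 Prop. 5.1, X.2 Prop. 2.4, C.§16 [SilvermanAEC2009]; L. C. Washington,
*Cyclotomic Fields*, Lemma 1.4 / Prop. 2.3 [Washington1997].
-/

noncomputable section

open scoped Classical NumberField

open WeierstrassCurve IsDedekindDomain IsDedekindDomain.HeightOneSpectrum NumberField
  Rat.HeightOneSpectrum Literature.NumberTheory.EllipticCurves
  Literature.NumberTheory.EllipticCurves.Rank1Residual
  Literature.NumberTheory.EllipticCurves.Delbourgo2002

namespace Summit.BirchSwinnertonDyer.Rank1Residual.Additive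

variable (W : WeierstrassCurve ℚ) [W.IsElliptic] (p : ℕ) [hp : Fact p.Prime]

/-! ### The reduction of `E_F` at a degree-one place above `p` IS the reduction of the twist `E^{(d)}`, `√d ∈ F` -/

omit [W.IsElliptic] in
/-- **Twisting isomorphism and point counts.** Let `F` be a number field containing `k` with
`k² = d`, `V/ℚ` a globally minimal model of the twist `E^{(d)}` (`C • V^{(d)} = W` for some change
of variables `C` over `ℚ` — the datum of the sub-cell's `exists_goodOrd_pStar_twist_model`) with GOOD
reduction at `p`, and `w ∋ p` a place of `F` with `N(w) = p`. Then `E_F` has good reduction at `w`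
and `#Ẽ_{F,w}(k_w) = #Ṽ(𝔽_p)` (`reductionPointCount V p`, the point count of `V`'s integral model
mod `p`): `E_F ≅ (V^{(d)})_F ≅ V_F` over `F`, good reduction and `a_w` are `F`-isomorphism
invariants, and `a_w(V_F) = a_p(V)`, `#k_w = p`. [cite: SilvermanAEC2009, X.2 Prop. 2.4, VII.1 Prop. 1.3(b) and C.§16] -/
theorem hasGoodReductionAt_and_natCard_point_reductionAt_eq_of_twist_model
    {F : Type} [Field F] [NumberField F] {d : ℚ} {k : F} (hk : k ^ 2 = algebraMap ℚ F d)
    (hk0 : k ≠ 0) (V : WeierstrassCurve ℚ) [V.IsElliptic] [V.IsGloballyMinimal]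
    (hWV : ∃ C : VariableChange ℚ, C • V.quadraticTwist d = W) (hV : V.HasGoodReductionAtPrime p)
    (w : HeightOneSpectrum (𝓞 F)) (hw : (p : 𝓞 F) ∈ w.asIdeal) (hN : Ideal.absNorm w.asIdeal = p) :
    (W.baseChange F).HasGoodReductionAt w ∧
      Nat.card ((W.baseChange F).reductionAt w).toAffine.Point = reductionPointCount V p := by
  -- the rational place `v` of `p` below `w`
  set v : HeightOneSpectrum (𝓞 ℚ) := (primesEquiv (R := 𝓞 ℚ)).symm ⟨p, hp.out⟩ with hvdef
  have hpv : (p : 𝓞 ℚ) ∈ v.asIdeal :=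
    (natCast_mem_asIdeal_iff_eq_primesEquiv_symm v hp.out).mpr rfl
  have hwv : w.asIdeal.under (𝓞 ℚ) = v.asIdeal := under_eq_asIdeal_of_natCast_mem p w hw
  haveI : w.asIdeal.LiesOver v.asIdeal := ⟨hwv.symm⟩
  -- `V` good at `v`, hence `V_F` good at `w`
  have hgv : V.HasGoodReductionAt v := hasGoodReductionAt_of_hasGoodReductionAtPrime p V hV
  have hgVF : (V.baseChange F).HasGoodReductionAt w :=
    hasGoodReductionAt_baseChange_of_hasGoodReductionAt V F v w hgv
  -- `W_F ≅ V_F`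
  obtain ⟨C₁, hC₁⟩ := hWV
  obtain ⟨C, hC⟩ := exists_variableChange_baseChange_eq_quadraticTwist V F hk hk0
  have hiso : (C₁.map (algebraMap ℚ F) * C) • V.baseChange F = W.baseChange F := by
    rw [mul_smul, hC, ← hC₁, baseChange, baseChange, ← map_variableChange]
  have hgW : (W.baseChange F).HasGoodReductionAt w := by
    rw [← hiso]
    exact (hasGoodReductionAt_smul_iff_holds w (V.baseChange F) _).2 hgVF
  refine ⟨hgW, ?_⟩
  -- `a_w(W_F) = a_w(V_F) = a_p(V)`, and `#k_w = p`
  haveI : (V.baseChange F).IsElliptic := by rw [baseChange]; infer_instance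
  have ha : (W.baseChange F).frobeniusTraceAt w = V.frobeniusTrace p := by
    rw [← hiso, frobeniusTraceAt_smul (V.baseChange F) _ w hgVF]
    exact frobeniusTraceAt_baseChange_eq_frobeniusTrace_prime V p w hw hN
      (not_dvd_minimalDiscriminantInt_of_hasGoodReductionAtPrime (W := V) p hV)
  rw [frobeniusTraceAt_def, natCard_residueField_eq_absNorm, hN, frobeniusTrace] at ha
  omega

/-! ### Defect 2: `ReductionNonAnomalous W p ↔ p ∤ #Ṽ(𝔽_p)` for the twist `V ≅ E^{(p*)}` -/

variable [W.IsGloballyMinimal]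

/-- **Delbourgo's non-anomalous clause on a defect-2 pair is decided by the twist `E^{(p*)}`.**
For `p ≠ 2`, `W/ℚ` globally minimal with semistability defect `e_E(p) = 2` (Kodaira `I₀*`), and `V`
a globally minimal model of `E^{(p*)}` (`C • V^{(p*)} = W`, `p* = (−1)^{⌊p/2⌋} p`) with GOOD
reduction at `p`: `ReductionNonAnomalous W p ↔ ¬ p ∣ #Ṽ(𝔽_p)`. (⇐) Every good place `w ∣ p` of a
subfield `F ⊆ ℚ(ζ_p)` has `2 = e_E(p) ∣ e(w|p) = [F : ℚ]`, so `√p* ∈ F` and the reduction at `w`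
is that of `V` over `k_w = 𝔽_p`; (⇒) the clause at `F = ℚ(√p*) ⊆ ℚ(ζ_p)`.
[cite: Delbourgo2002, p. 39 (ℓ_p(E), Ĩ(𝔽_p)) and pp. 69–70] [cite: Washington1997, Lemma 1.4 and Prop. 2.3] -/
theorem reductionNonAnomalous_iff_of_semistabilityIndex_eq_two (hp2 : p ≠ 2)
    (he : semistabilityIndex W p = 2) (V : WeierstrassCurve ℚ) [V.IsElliptic] [V.IsGloballyMinimal]
    (hWV : ∃ C : VariableChange ℚ, C • V.quadraticTwist ((-1 : ℚ) ^ (p / 2) * p) = W)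
    (hV : V.HasGoodReductionAtPrime p) :
    ReductionNonAnomalous W p ↔ ¬ p ∣ reductionPointCount V p := by
  constructor
  · -- (⇒): evaluate at `F = ℚ(g) ⊆ L = ℚ(ζ_p)`, `g² = p*`
    intro h
    haveI hcycL : IsCyclotomicExtension {p} ℚ (CyclotomicField p ℚ) := by
      have hq : (CyclotomicField.algebra p ℚ : Algebra ℚ (CyclotomicField p ℚ)) =
          DivisionRing.toRatAlgebra := Subsingleton.elim _ _
      exact hq ▸ CyclotomicField.isCyclotomicExtension p ℚ
    obtain ⟨g, hg⟩ := exists_sq_eq_pStar p (CyclotomicField p ℚ) hp2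
    set F : IntermediateField ℚ (CyclotomicField p ℚ) := IntermediateField.adjoin ℚ {g} with hFdef
    haveI : NumberField F := NumberField.of_module_finite ℚ F
    have hgF : g ∈ F := IntermediateField.mem_adjoin_simple_self ℚ g
    obtain ⟨w, hw⟩ := exists_heightOneSpectrum_natCast_mem F p
    haveI := liesOver_span_of_natCast_mem p F w hw
    have hN : Ideal.absNorm w.asIdeal = p := absNorm_eq_of_intermediateField_cyclotomic p F w
    have hk : ((⟨g, hgF⟩ : F) : F) ^ 2 = algebraMap ℚ F ((-1 : ℚ) ^ (p / 2) * p) := by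
      apply Subtype.ext
      simp only [map_mul, map_pow, map_neg, map_one, map_natCast]
      exact hg
    have hg0 : g ≠ 0 := by
      intro h0
      rw [h0, zero_pow two_ne_zero] at hg
      exact mul_ne_zero (pow_ne_zero _ (neg_ne_zero.mpr one_ne_zero))
        (Nat.cast_ne_zero.mpr hp.out.ne_zero) hg.symm
    have hk0 : ((⟨g, hgF⟩ : F) : F) ≠ 0 := fun h0 ↦ hg0 (congrArg Subtype.val h0)
    obtain ⟨hgood, hcard⟩ := hasGoodReductionAt_and_natCard_point_reductionAt_eq_of_twist_model W p
      hk hk0 V hWV hV w hw hN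
    rw [← hcard]
    exact h (CyclotomicField p ℚ) F w hw hgood
  · -- (⇐): any good place above `p` in a subfield of `ℚ(ζ_p)` sees the reduction of `V`
    intro h L _ _ _ F w hw hgood
    haveI : NumberField F := NumberField.of_module_finite ℚ F
    obtain ⟨g, hg⟩ := exists_sq_eq_pStar p L hp2
    haveI := liesOver_span_of_natCast_mem p F w hw
    have h2 : 2 ∣ Module.finrank ℚ F := by
      rw [← ramificationIdx_eq_finrank_of_intermediateField_cyclotomic p F w, ← he]
      exact semistabilityIndex_dvd_ramificationIdx_of_hasGoodReductionAt W p F w hw hgood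
    have hgF : g ∈ F := (mem_iff_two_dvd_finrank_of_sq_eq_pStar p hg F).mpr h2
    have hN : Ideal.absNorm w.asIdeal = p := absNorm_eq_of_intermediateField_cyclotomic p F w
    have hk : ((⟨g, hgF⟩ : F) : F) ^ 2 = algebraMap ℚ F ((-1 : ℚ) ^ (p / 2) * p) := by
      apply Subtype.ext
      simp only [map_mul, map_pow, map_neg, map_one, map_natCast]
      exact hg
    have hg0 : g ≠ 0 := by
      intro h0
      rw [h0, zero_pow two_ne_zero] at hg
      exact mul_ne_zero (pow_ne_zero _ (neg_ne_zero.mpr one_ne_zero))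
        (Nat.cast_ne_zero.mpr hp.out.ne_zero) hg.symm
    have hk0 : ((⟨g, hgF⟩ : F) : F) ≠ 0 := fun h0 ↦ hg0 (congrArg Subtype.val h0)
    obtain ⟨-, hcard⟩ := hasGoodReductionAt_and_natCard_point_reductionAt_eq_of_twist_model W p
      hk hk0 V hWV hV w hw hN
    rw [hcard]
    exact h

/-- **The same in the currency of `a_p`**: on a defect-2 pair (`p ≠ 2`, `V ≅ E^{(p*)}` globally
minimal and good at `p`), `ReductionNonAnomalous W p ↔ ¬ (p : ℤ) ∣ a_p(V) − 1` — "the twist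
`E^{(p*)}` is not anomalous at `p`" (`a_p(V) = p + 1 − #Ṽ(𝔽_p)`). At `p = 3` with `V` ordinary this
reads `a₃(E^{(−3)}) ∈ {−1, 2}` (twist-sign convention of record: `d = −3`).
[cite: Delbourgo2002, p. 39 (ℓ_p(E), Ĩ(𝔽_p))] [cite: Mazur1972, §1 (anomalous primes)] -/
theorem reductionNonAnomalous_iff_not_dvd_frobeniusTrace_sub_one_of_semistabilityIndex_eq_two
    (hp2 : p ≠ 2) (he : semistabilityIndex W p = 2) (V : WeierstrassCurve ℚ) [V.IsElliptic]
    [V.IsGloballyMinimal]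
    (hWV : ∃ C : VariableChange ℚ, C • V.quadraticTwist ((-1 : ℚ) ^ (p / 2) * p) = W)
    (hV : V.HasGoodReductionAtPrime p) :
    ReductionNonAnomalous W p ↔ ¬ (p : ℤ) ∣ V.frobeniusTrace p - 1 := by
  rw [reductionNonAnomalous_iff_of_semistabilityIndex_eq_two W p hp2 he V hWV hV, frobeniusTrace,
    not_iff_not]
  constructor
  · rintro ⟨c, hc⟩
    exact ⟨1 - c, by push_cast [hc]; ring⟩
  · rintro ⟨c, hc⟩
    refine Int.natCast_dvd_natCast.mp ⟨1 - c, ?_⟩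
    linear_combination -hc

/-- **Record form**: with `V`'s integral model `E₀` and a KERNEL point count `#(E₀ mod p)(𝔽_p) = n`,
`p ∤ n` gives `ReductionNonAnomalous W p` on a defect-2 pair — the per-pair discharge of the binder
`hna` of the rank-one (G-ord) chain (T-O7K3 / `GordRankOneKatoCertificateBSD`), next to
`frobeniusTrace_eq` / `reductionPointCount_eq_of_intModel`. [cite: Delbourgo2002, p. 39 (ℓ_p(E), Ĩ(𝔽_p))] -/
theorem reductionNonAnomalous_of_semistabilityIndex_eq_two_of_intModel (hp2 : p ≠ 2)
    (he : semistabilityIndex W p = 2) (V : WeierstrassCurve ℚ) [V.IsElliptic] [V.IsGloballyMinimal]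
    (hWV : ∃ C : VariableChange ℚ, C • V.quadraticTwist ((-1 : ℚ) ^ (p / 2) * p) = W)
    (hV : V.HasGoodReductionAtPrime p) {E₀ : WeierstrassCurve ℤ} (hI : integralModelInt V = E₀)
    {n : ℕ} (hc : Nat.card ((E₀.map (Int.castRingHom (ZMod p))).toAffine.Point) = n)
    (hn : ¬ p ∣ n) : ReductionNonAnomalous W p := by
  refine (reductionNonAnomalous_iff_of_semistabilityIndex_eq_two W p hp2 he V hWV hV).mpr ?_
  rwa [GaloisImage.reductionPointCount_eq_of_intModel hI p, hc]

end Summit.BirchSwinnertonDyer.Rank1Residual.Additive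

end
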